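import Summits.NavierStokesRegularity.NavierStokesRegularity.Theorems.ScenarioCensusDeviatorMeterStress
import Summits.NavierStokesRegularity.NavierStokesRegularity.Theorems.ScenarioCensusRoughnessMeter
import Summits.NavierStokesRegularity.NavierStokesRegularity.Theorems.ScenarioCensusDiffusionMeterRows
import HarnessLib

/-!
# LINE «deviator-meter» port, part 3/4: §F engine I — isotropy above a relative scale (mixed thresholds); §G engine II — the scale-weighted universal meter

Re-homed for the scenario census (typer seat ns-census-typer-1 g8; cells of ns-idea-2 g14 LINE g14-4 «deviator-meter», rev 2 528544c56f6257b6 = rev 1 + one nesting (ref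
ns-census-ref §15.23 / §15.27 ✓, critic idea-crit-3 PASS — no price), members of block A2 booked by the lead since census v1.79 / v1.80; this port makes the decided cells
TREE-decided): VERBATIM PORT of `pub/ideators/ns-idea-2/lines/deviator-meter/line-deviator-meter.rev2.lean` sha16 528544c56f6257b6 (1325 l., lean check rc 0, 0 sorry), split
for the 400-line rule into `ScenarioCensusDeviatorMeter` (§A–§C) → `…DeviatorMeterStress` (§D–§E) → `…DeviatorMeterEngine` (§F–§G) → `…DeviatorMeterRows` (§H–§J + census
KEYS).  Lean text VERBATIM in namespace `…Theorems.ScenarioCensus.DeviatorMeter` (the line's `…Lines.DeviatorMeter` re-homed); port edits: `local notation "E3"` →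
`abbrev E3` (typer lint: no notation in port files), `@[conjecture]` on the OPEN rows `Row_A2dn` / `Row_A2dl` (typed only), one-line docstrings added where missing (gate lint);
lemmas and the constant `kernelConst` that the line shares VERBATIM with the landed roughness-meter / diffusion-meter ports are taken BY NAME (listed below).  Statements
untouched.

No census VALUE is moved here (the cells become TREE-decided by name; booking is the lead's); NS regularity is NOT proved; (L′) ⟨10661⟩ is untouched; no summit
statement is proved by this file. Lemmas that restate already-landed tree declarations are taken BY NAME (gate lint `dedup.landed`): `kernelConst` = `RoughnessMeter.kernelConst`, `kernelConst_pos` = `RoughnessMeter.kernelConst_pos`, `kernelConst_spec` = `RoughnessMeter.kernelConst_spec`, `integrableOn_sub_rpow` = `RoughnessMeter.integrableOn_sub_rpow`, `setIntegral_sub_rpow` = `RoughnessMeter.setIntegral_sub_rpow`, `eq_zero_of_small_backward_end` = `DiffusionMeter.eq_zero_of_small_backward_end`.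
-/

-- the summit and its single problem share the name `NavierStokesRegularity` (D-0017 nested layout)
set_option linter.dupNamespace false

noncomputable section

open Set Function Filter Topology Metric MeasureTheory
open scoped RealInnerProductSpace

namespace Summit.NavierStokesRegularity.NavierStokesRegularity.Theorems.ScenarioCensus.DeviatorMeter

open Literature.Analysis Literature.Analysis.FluidPDE
open Summit.NavierStokesRegularity.NavierStokesRegularity.Theorems.SimilarityEnstrophy
  (typeI_ancient_eq_zero_of_rate_lt_one)
open Summit.NavierStokesRegularity.NavierStokesRegularity.Theorems.SymmetryModuliCountSymmetricLiouville
  (vanishes_of_vanishes_before)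

/-! ## F. Engine I — isotropy above a relative scale `θ` (mixed thresholds)

Hypothesis on the backward end `τ < T₀`: `|D[u](τ,s)ⱼₖ(y)| ≤ δ/(-τ)` for every scale
`s ≥ θ(-τ)`.  Lags `σ = t - τ ≥ 4θ(-t)` have `σ/2 ≥ θ(-τ)` and are bounded by the deviatoric slice
bound with `B = δ/(-t)`; shorter lags by the same bound with the free value `B = M C/(-t)`.  One
pointwise majorant `c₁ σ^{-1/2} + c₂ σ^{-3/4}` covers both (`1 ≤ (4θ(-t)/σ)^{1/4}` on short lags);
its window integral is `(18√2 CI δ + 36√2 (4θ)^{1/4} CI C M)/√(-t)`. -/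

/-- **One window, engine I.** -/
theorem step_above_scale {C : ℝ} {u : ℝ → E3 → E3} (hu : IsTypeIAncientMild C u) {T₀ : ℝ}
    (hT₀ : T₀ ≤ 0) {θ δ : ℝ} (hθ : 0 < θ) (hδ : 0 ≤ δ)
    (hdev : ∀ τ < T₀, ∀ s : ℝ, θ * (-τ) ≤ s → ∀ y j k, |devStress u τ s j k y| ≤ δ / (-τ))
    {M : ℝ} (hM0 : 0 ≤ M) (hM : ∀ τ < T₀, ∀ y, Real.sqrt (-τ) * ‖u τ y‖ ≤ M) :
    ∀ t < T₀, ∀ x, Real.sqrt (-t) * ‖u t x‖ ≤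
      M / Real.sqrt 2 + 18 * Real.sqrt 2 * CI * δ + 36 * Real.sqrt 2 * (4 * θ) ^ ((1:ℝ)/4) * CI * C * M := by
  intro t ht x
  have ht0 : t < 0 := lt_of_lt_of_le ht hT₀
  have hC0 : 0 ≤ C := hu.nonneg
  have hCI := CI_pos
  set T : ℝ := -t with hT
  have hTpos : 0 < T := by rw [hT]; linarith
  have hsT : 0 < Real.sqrt T := Real.sqrt_pos.2 hTpos
  -- the majorant
  set c₁ : ℝ := 9 * Real.sqrt 2 * CI * (δ / T) with hc₁
  set c₂ : ℝ := 9 * Real.sqrt 2 * CI * (M * C / T) * (4 * θ * T) ^ ((1:ℝ)/4) with hc₂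
  have hc₁0 : 0 ≤ c₁ := by positivity
  have hc₂0 : 0 ≤ c₂ := by positivity
  set g : ℝ → ℝ := fun τ => c₁ * (t - τ) ^ (-(1:ℝ)/2) + c₂ * (t - τ) ^ (-(3:ℝ)/4) with hg
  have hr1 : -1 < -(1:ℝ)/2 := by norm_num
  have hr2 : -1 < -(3:ℝ)/4 := by norm_num
  have hgi : IntegrableOn g (Ioo (2 * t) t) :=
    ((RoughnessMeter.integrableOn_sub_rpow ht0 hr1).const_mul c₁).add ((RoughnessMeter.integrableOn_sub_rpow ht0 hr2).const_mul c₂)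
  -- pointwise slice bound on the window
  have hpt : ∀ τ ∈ Ioo (2 * t) t, ∀ x, ‖oseenSlice (t - τ) (u τ) (u τ) x‖ ≤ g τ := by
    intro τ hτ x
    have hτT₀ : τ < T₀ := hτ.2.trans ht
    have hτ0 : τ < 0 := hτ.2.trans ht0
    set σ : ℝ := t - τ with hσ
    have hσ0 : 0 < σ := by rw [hσ]; linarith [hτ.2]
    have hσT : σ < T := by rw [hσ, hT]; linarith [hτ.1]
    have hτT : T < -τ := by rw [hT]; linarith [hτ.2]
    have hτ2T : -τ < 2 * T := by rw [hT]; linarith [hτ.1]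
    have hsτ : 0 < Real.sqrt (-τ) := Real.sqrt_pos.2 (by linarith)
    have hcont : Continuous (u τ) := hu.continuous_slice hτ0
    have hbnd : ∀ z, ‖u τ z‖ ≤ C / Real.sqrt (-τ) := fun z => hu.norm_le hτ0 z
    have hhalf : (σ / 2) ^ (-(1:ℝ)/2) = Real.sqrt 2 * σ ^ (-(1:ℝ)/2) := by
      rw [Real.div_rpow hσ0.le (by norm_num : (0:ℝ) ≤ 2), div_eq_mul_inv, mul_comm]
      congr 1
      rw [← Real.rpow_neg (by norm_num : (0:ℝ) ≤ 2), neg_div, neg_neg, ← Real.sqrt_eq_rpow]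
    have hw1 : 0 ≤ σ ^ (-(1:ℝ)/2) := Real.rpow_nonneg hσ0.le _
    have hw2 : 0 ≤ σ ^ (-(3:ℝ)/4) := Real.rpow_nonneg hσ0.le _
    by_cases hcase : 4 * θ * T ≤ σ
    · -- long lag: the deviator hypothesis at scale σ/2 ≥ θ(-τ)
      have hscale : θ * (-τ) ≤ σ / 2 := by nlinarith
      have hB : ∀ w j k, |UnboundedOperators.heatExtension (devFun (u τ) j k) (σ / 2) w| ≤ δ / (-τ) :=
        fun w j k => hdev τ hτT₀ (σ / 2) hscale w j k
      have hB0 : 0 ≤ δ / (-τ) := div_nonneg hδ (by linarith)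
      have key := norm_oseenSlice_le_of_dev hcont hbnd hσ0 hB0 hB x
      refine key.trans ?_
      rw [hhalf, hg]
      have h1 : δ / (-τ) ≤ δ / T := div_le_div_of_nonneg_left hδ hTpos hτT.le
      have : 9 * CI * (δ / (-τ)) * (Real.sqrt 2 * σ ^ (-(1:ℝ)/2)) ≤ c₁ * σ ^ (-(1:ℝ)/2) := by
        rw [hc₁]
        have : 9 * CI * (δ / (-τ)) * (Real.sqrt 2 * σ ^ (-(1:ℝ)/2)) =
            9 * Real.sqrt 2 * CI * (δ / (-τ)) * σ ^ (-(1:ℝ)/2) := by ring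
        rw [this]
        gcongr
      dsimp only
      linarith [mul_nonneg hc₂0 hw2]
    · -- short lag: the free value of the meter
      rw [not_le] at hcase
      have hB : ∀ w j k, |UnboundedOperators.heatExtension (devFun (u τ) j k) (σ / 2) w| ≤ M * C / (-τ) :=
        fun w j k => abs_devStress_le_amp hu hτ0 (hM τ hτT₀) (by positivity : 0 < σ / 2) j k w
      have hB0 : 0 ≤ M * C / (-τ) := div_nonneg (mul_nonneg hM0 hC0) (by linarith)
      have key := norm_oseenSlice_le_of_dev hcont hbnd hσ0 hB0 hB x
      refine key.trans ?_
      rw [hhalf, hg]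
      have h1 : M * C / (-τ) ≤ M * C / T := div_le_div_of_nonneg_left (mul_nonneg hM0 hC0) hTpos hτT.le
      -- σ^{-1/2} ≤ (4θT)^{1/4} σ^{-3/4} on short lags
      have hsplit : σ ^ (-(1:ℝ)/2) = σ ^ ((1:ℝ)/4) * σ ^ (-(3:ℝ)/4) := by
        rw [← Real.rpow_add hσ0]; norm_num
      have hquarter : σ ^ ((1:ℝ)/4) ≤ (4 * θ * T) ^ ((1:ℝ)/4) :=
        Real.rpow_le_rpow hσ0.le hcase.le (by norm_num)
      have : 9 * CI * (M * C / (-τ)) * (Real.sqrt 2 * σ ^ (-(1:ℝ)/2)) ≤ c₂ * σ ^ (-(3:ℝ)/4) := by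
        rw [hc₂, hsplit]
        have : 9 * CI * (M * C / (-τ)) * (Real.sqrt 2 * (σ ^ ((1:ℝ)/4) * σ ^ (-(3:ℝ)/4))) =
            9 * Real.sqrt 2 * CI * (M * C / (-τ)) * σ ^ ((1:ℝ)/4) * σ ^ (-(3:ℝ)/4) := by ring
        rw [this]
        gcongr
      dsimp only
      linarith [mul_nonneg hc₁0 hw1]
  have hwb := window_bound hu hT₀ ht hM hgi hpt x
  -- evaluate the majorant integral
  have hI : ∫ τ in Ioo (2 * t) t, g τ = 2 * c₁ * Real.sqrt T + 4 * c₂ * T ^ ((1:ℝ)/4) := by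
    rw [hg]
    dsimp only
    rw [integral_add ((RoughnessMeter.integrableOn_sub_rpow ht0 hr1).const_mul c₁)
      ((RoughnessMeter.integrableOn_sub_rpow ht0 hr2).const_mul c₂), integral_const_mul, integral_const_mul,
      RoughnessMeter.setIntegral_sub_rpow ht0 hr1, RoughnessMeter.setIntegral_sub_rpow ht0 hr2]
    have e1 : -(1:ℝ)/2 + 1 = 1/2 := by norm_num
    have e2 : -(3:ℝ)/4 + 1 = 1/4 := by norm_num
    rw [e1, e2, ← hT, show (T ^ (1/2 : ℝ)) = Real.sqrt T by rw [Real.sqrt_eq_rpow]]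
    ring
  rw [hI] at hwb
  -- bookkeeping: multiply by √T
  have hsq2 : Real.sqrt (-(2 * t)) = Real.sqrt 2 * Real.sqrt T := by rw [hT]; exact sqrt_neg_two_mul t
  have hs2pos : 0 < Real.sqrt 2 := Real.sqrt_pos.2 (by norm_num)
  have hTq : (4 * θ * T) ^ ((1:ℝ)/4) * T ^ ((1:ℝ)/4) = (4 * θ) ^ ((1:ℝ)/4) * Real.sqrt T := by
    rw [Real.mul_rpow (by positivity : (0:ℝ) ≤ 4 * θ) hTpos.le, mul_assoc, ← Real.rpow_add hTpos,
      show (1:ℝ)/4 + 1/4 = 1/2 by norm_num, Real.sqrt_eq_rpow]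
  rw [show Real.sqrt (-t) = Real.sqrt T by rw [hT]]
  rw [hsq2] at hwb
  set S : ℝ := Real.sqrt T with hS
  have hS0 : 0 < S := hsT
  have hTS : T = S * S := by rw [hS]; exact (Real.mul_self_sqrt hTpos.le).symm
  have e1 : S * (M / (Real.sqrt 2 * S)) = M / Real.sqrt 2 := by
    field_simp
  have e2 : S * (2 * c₁ * S) = 18 * Real.sqrt 2 * CI * δ := by
    rw [hc₁, hTS]
    field_simp
    ring
  have e3 : S * (4 * c₂ * T ^ ((1:ℝ)/4)) = 36 * Real.sqrt 2 * (4 * θ) ^ ((1:ℝ)/4) * CI * C * M := by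
    rw [hc₂]
    have : S * (4 * (9 * Real.sqrt 2 * CI * (M * C / T) * (4 * θ * T) ^ ((1:ℝ)/4)) * T ^ ((1:ℝ)/4)) =
        36 * Real.sqrt 2 * CI * (M * C / T) * S * ((4 * θ * T) ^ ((1:ℝ)/4) * T ^ ((1:ℝ)/4)) := by
      ring
    rw [this, hTq]
    set Q : ℝ := (4 * θ) ^ ((1:ℝ)/4)
    rw [hTS]
    field_simp
  calc S * ‖u t x‖
      ≤ S * (M / (Real.sqrt 2 * S) + (2 * c₁ * S + 4 * c₂ * T ^ ((1:ℝ)/4))) :=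
        mul_le_mul_of_nonneg_left hwb hS0.le
    _ = M / Real.sqrt 2 + 18 * Real.sqrt 2 * CI * δ +
          36 * Real.sqrt 2 * (4 * θ) ^ ((1:ℝ)/4) * CI * C * M := by
        rw [mul_add, mul_add, e1, e2, e3, add_assoc]

/-- **Engine I, conclusion.**  With the universal `δ₀ = (1 - 1/√2)/(72√2·CI)` and the
`C`-dependent relative scale `θ ≤ θ₀(C) = ¼ ((1 - 1/√2)/(144√2·CI(|C|+1)))⁴`, isotropy above
scale `θ` on a backward end forces `u ≡ 0`. -/
def devThreshold : ℝ := (1 - 1 / Real.sqrt 2) / (72 * Real.sqrt 2 * CI)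

/-- The deviatoric threshold is positive. -/
theorem devThreshold_pos : 0 < devThreshold := by
  unfold devThreshold
  have h1 := one_div_sqrt_two_lt_one
  have h2 := CI_pos
  have h3 : 0 < Real.sqrt 2 := Real.sqrt_pos.2 (by norm_num)
  apply div_pos <;> nlinarith

/-- The admissible relative scale for constant `C`. -/
def scaleThreshold (C : ℝ) : ℝ :=
  ((1 - 1 / Real.sqrt 2) / (144 * Real.sqrt 2 * CI * (|C| + 1))) ^ 4 / 4

/-- The scale threshold is positive. -/
theorem scaleThreshold_pos (C : ℝ) : 0 < scaleThreshold C := by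
  unfold scaleThreshold
  have h1 := one_div_sqrt_two_lt_one
  have h2 := CI_pos
  have h3 : 0 < Real.sqrt 2 := Real.sqrt_pos.2 (by norm_num)
  have h4 : 0 < (1 - 1 / Real.sqrt 2) / (144 * Real.sqrt 2 * CI * (|C| + 1)) := by
    apply div_pos <;> [linarith; positivity]
  positivity

/-- Engine I in (L′)-shape: isotropy above a relative scale forces `u ≡ 0`. -/
theorem eq_zero_of_dev_above_scale {C : ℝ} {u : ℝ → E3 → E3} (hu : IsTypeIAncientMild C u)
    {T₀ : ℝ} (hT₀ : T₀ ≤ 0) {θ : ℝ} (hθ : 0 < θ) (hθC : θ ≤ scaleThreshold C)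
    (hdev : ∀ τ < T₀, ∀ s : ℝ, θ * (-τ) ≤ s → ∀ y j k, |devStress u τ s j k y| ≤ devThreshold / (-τ)) :
    ∀ t < 0, ∀ x, u t x = 0 := by
  have hC0 : 0 ≤ C := hu.nonneg
  have hCI := CI_pos
  have hs2pos : 0 < Real.sqrt 2 := Real.sqrt_pos.2 (by norm_num)
  set κ : ℝ := 1 - 1 / Real.sqrt 2 with hκ
  have hκ0 : 0 < κ := by rw [hκ]; linarith [one_div_sqrt_two_lt_one]
  set a : ℝ := 36 * Real.sqrt 2 * (4 * θ) ^ ((1:ℝ)/4) * CI * C with ha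
  set b : ℝ := 18 * Real.sqrt 2 * CI * devThreshold with hb
  have ha0 : 0 ≤ a := by positivity
  -- a ≤ κ/4
  have hx0 : 0 ≤ κ / (144 * Real.sqrt 2 * CI * (|C| + 1)) := by positivity
  have h4θ : (4 * θ) ^ ((1:ℝ)/4) ≤ κ / (144 * Real.sqrt 2 * CI * (|C| + 1)) := by
    have hle : 4 * θ ≤ (κ / (144 * Real.sqrt 2 * CI * (|C| + 1))) ^ 4 := by
      have := hθC; unfold scaleThreshold at this; rw [← hκ] at this; linarith
    calc (4 * θ) ^ ((1:ℝ)/4) ≤ ((κ / (144 * Real.sqrt 2 * CI * (|C| + 1))) ^ 4) ^ ((1:ℝ)/4) :=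
          Real.rpow_le_rpow (by positivity) hle (by norm_num)
      _ = κ / (144 * Real.sqrt 2 * CI * (|C| + 1)) := by
          rw [show ((1:ℝ)/4) = ((4:ℕ) : ℝ)⁻¹ by norm_num]
          exact Real.pow_rpow_inv_natCast hx0 (by norm_num)
  have haκ : a ≤ κ / 4 := by
    rw [ha]
    have hCabs : C ≤ |C| := le_abs_self C
    calc 36 * Real.sqrt 2 * (4 * θ) ^ ((1:ℝ)/4) * CI * C
        ≤ 36 * Real.sqrt 2 * (κ / (144 * Real.sqrt 2 * CI * (|C| + 1))) * CI * |C| := by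
          gcongr
      _ = (κ / 4) * (|C| / (|C| + 1)) := by field_simp; ring
      _ ≤ (κ / 4) * 1 := by
          gcongr
          rw [div_le_one (by positivity)]; linarith
      _ = κ / 4 := mul_one _
  have hbκ : b = κ / 4 := by
    rw [hb, devThreshold, ← hκ]; field_simp; ring
  set q : ℝ := 1 / Real.sqrt 2 + a with hq
  have hq0 : 0 ≤ q := by positivity
  have h1κ : 1 / Real.sqrt 2 = 1 - κ := by rw [hκ]; ring
  have hq1 : q < 1 := by rw [hq]; linarith
  have hstep : ∀ M : ℝ, 0 ≤ M → (∀ τ < T₀, ∀ y, Real.sqrt (-τ) * ‖u τ y‖ ≤ M) →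
      ∀ τ < T₀, ∀ y, Real.sqrt (-τ) * ‖u τ y‖ ≤ q * M + b := by
    intro M hM0 hM τ hτ y
    have h := step_above_scale hu hT₀ hθ devThreshold_pos.le hdev hM0 hM τ hτ y
    rw [hq, hb]
    have e : M / Real.sqrt 2 + 18 * Real.sqrt 2 * CI * devThreshold +
        36 * Real.sqrt 2 * (4 * θ) ^ ((1:ℝ)/4) * CI * C * M =
        (1 / Real.sqrt 2 + a) * M + 18 * Real.sqrt 2 * CI * devThreshold := by rw [ha]; ring
    linarith [e]
  have hlim := amplitude_le_of_affine_step hu hT₀ hq0 hq1 (by rw [hbκ]; positivity) hstep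
  have hm : b / (1 - q) < 1 := by
    rw [div_lt_one (by linarith)]
    rw [hbκ, hq, h1κ]
    linarith
  exact DiffusionMeter.eq_zero_of_small_backward_end hu hT₀ hm hlim

/-! ## G. Engine II — the scale-weighted universal meter

Hypothesis on the backward end: `|D[u](τ,s)ⱼₖ(y)| ≤ δ (-τ)^{β-1} s^{-β}` for all `0 < s < -τ`,
i.e. `δ (-τ)^{-1} (s/(-τ))^{-β}` — small scales are allowed to blow up at the rate `s^{-β}`,
`β < 1/2`.  The window integral is `9·2^{1/2+β} CI/(1/2-β) · δ/√(-t)`, uniformly in `C`. -/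

/-- The constant `K_β = 9 · 2^{1/2+β} · CI / (1/2 - β)`. -/
def weightConst (β : ℝ) : ℝ := 9 * (2:ℝ) ^ (1/2 + β) * CI / (1/2 - β)

/-- The weight constant is positive for `β < 1/2`. -/
theorem weightConst_pos {β : ℝ} (hβ : β < 1/2) : 0 < weightConst β := by
  unfold weightConst
  have := CI_pos
  have h2 : 0 < (2:ℝ) ^ (1/2 + β) := Real.rpow_pos_of_pos (by norm_num) _
  apply div_pos <;> [positivity; linarith]

/-- **One window, engine II.** -/
theorem step_weighted {C : ℝ} {u : ℝ → E3 → E3} (hu : IsTypeIAncientMild C u) {T₀ : ℝ}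
    (hT₀ : T₀ ≤ 0) {β δ : ℝ} (hβ : β < 1/2) (hδ : 0 ≤ δ)
    (hdev : ∀ τ < T₀, ∀ s : ℝ, 0 < s → s < -τ → ∀ y j k,
      |devStress u τ s j k y| ≤ δ * (-τ) ^ (β - 1) * s ^ (-β))
    {M : ℝ} (hM : ∀ τ < T₀, ∀ y, Real.sqrt (-τ) * ‖u τ y‖ ≤ M) :
    ∀ t < T₀, ∀ x, Real.sqrt (-t) * ‖u t x‖ ≤ M / Real.sqrt 2 + weightConst β * δ := by
  intro t ht x
  have ht0 : t < 0 := lt_of_lt_of_le ht hT₀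
  have hCI := CI_pos
  set T : ℝ := -t with hT
  have hTpos : 0 < T := by rw [hT]; linarith
  have hsT : 0 < Real.sqrt T := Real.sqrt_pos.2 hTpos
  set r : ℝ := -(1/2 + β) with hr
  have hr1 : -1 < r := by rw [hr]; linarith
  set c : ℝ := 9 * CI * δ * T ^ (β - 1) * (2:ℝ) ^ (1/2 + β) with hc
  have hc0 : 0 ≤ c := by positivity
  set g : ℝ → ℝ := fun τ => c * (t - τ) ^ r with hg
  have hgi : IntegrableOn g (Ioo (2 * t) t) := (RoughnessMeter.integrableOn_sub_rpow ht0 hr1).const_mul c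
  have hpt : ∀ τ ∈ Ioo (2 * t) t, ∀ x, ‖oseenSlice (t - τ) (u τ) (u τ) x‖ ≤ g τ := by
    intro τ hτ x
    have hτT₀ : τ < T₀ := hτ.2.trans ht
    have hτ0 : τ < 0 := hτ.2.trans ht0
    set σ : ℝ := t - τ with hσ
    have hσ0 : 0 < σ := by rw [hσ]; linarith [hτ.2]
    have hσT : σ < T := by rw [hσ, hT]; linarith [hτ.1]
    have hτT : T < -τ := by rw [hT]; linarith [hτ.2]
    have hcont : Continuous (u τ) := hu.continuous_slice hτ0
    have hbnd : ∀ z, ‖u τ z‖ ≤ C / Real.sqrt (-τ) := fun z => hu.norm_le hτ0 z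
    have hs2 : 0 < σ / 2 := by positivity
    have hs2lt : σ / 2 < -τ := by linarith
    set B : ℝ := δ * (-τ) ^ (β - 1) * (σ / 2) ^ (-β) with hB
    have hB0 : 0 ≤ B := by
      rw [hB]
      exact mul_nonneg (mul_nonneg hδ (Real.rpow_nonneg (by linarith) _)) (Real.rpow_nonneg hs2.le _)
    have hBw : ∀ w j k, |UnboundedOperators.heatExtension (devFun (u τ) j k) (σ / 2) w| ≤ B :=
      fun w j k => hdev τ hτT₀ (σ / 2) hs2 hs2lt w j k
    have key := norm_oseenSlice_le_of_dev hcont hbnd hσ0 hB0 hBw x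
    refine key.trans ?_
    rw [hg, hB]
    dsimp only
    -- (-τ)^{β-1} ≤ T^{β-1}
    have h1 : (-τ) ^ (β - 1) ≤ T ^ (β - 1) :=
      Real.rpow_le_rpow_of_nonpos hTpos hτT.le (by linarith)
    -- (σ/2)^{-β} (σ/2)^{-1/2} = 2^{1/2+β} σ^r
    have h2 : (σ / 2) ^ (-β) * (σ / 2) ^ (-(1:ℝ)/2) = (2:ℝ) ^ (1/2 + β) * σ ^ r := by
      rw [← Real.rpow_add hs2, Real.div_rpow hσ0.le (by norm_num : (0:ℝ) ≤ 2)]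
      rw [show -β + -(1:ℝ)/2 = r by rw [hr]; ring, div_eq_mul_inv, ← Real.rpow_neg (by norm_num : (0:ℝ) ≤ 2),
        hr, neg_neg, mul_comm]
    have hσr : 0 ≤ σ ^ r := Real.rpow_nonneg hσ0.le _
    calc 9 * CI * (δ * (-τ) ^ (β - 1) * (σ / 2) ^ (-β)) * (σ / 2) ^ (-(1:ℝ)/2)
        = 9 * CI * δ * (-τ) ^ (β - 1) * ((σ / 2) ^ (-β) * (σ / 2) ^ (-(1:ℝ)/2)) := by ring
      _ = 9 * CI * δ * (-τ) ^ (β - 1) * ((2:ℝ) ^ (1/2 + β) * σ ^ r) := by rw [h2]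
      _ ≤ 9 * CI * δ * T ^ (β - 1) * ((2:ℝ) ^ (1/2 + β) * σ ^ r) := by
          gcongr
      _ = c * σ ^ r := by rw [hc]; ring
  have hwb := window_bound hu hT₀ ht hM hgi hpt x
  have hI : ∫ τ in Ioo (2 * t) t, g τ = c * (T ^ (r + 1) / (r + 1)) := by
    rw [hg]
    dsimp only
    rw [integral_const_mul, RoughnessMeter.setIntegral_sub_rpow ht0 hr1, ← hT]
  rw [hI] at hwb
  have hsq2 : Real.sqrt (-(2 * t)) = Real.sqrt 2 * Real.sqrt T := by rw [hT]; exact sqrt_neg_two_mul t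
  have hs2pos : 0 < Real.sqrt 2 := Real.sqrt_pos.2 (by norm_num)
  have hr' : r + 1 = 1/2 - β := by rw [hr]; ring
  have hpow : Real.sqrt T * (T ^ (β - 1) * T ^ (r + 1)) = 1 := by
    rw [hr', ← Real.rpow_add hTpos, Real.sqrt_eq_rpow, ← Real.rpow_add hTpos]
    rw [show (1:ℝ)/2 + (β - 1 + (1/2 - β)) = 0 by ring, Real.rpow_zero]
  rw [show Real.sqrt (-t) = Real.sqrt T by rw [hT]]
  calc Real.sqrt T * ‖u t x‖
      ≤ Real.sqrt T * (M / Real.sqrt (-(2 * t)) + c * (T ^ (r + 1) / (r + 1))) :=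
        mul_le_mul_of_nonneg_left hwb hsT.le
    _ = M / Real.sqrt 2 + weightConst β * δ := by
        rw [hsq2, mul_add]
        congr 1
        · field_simp
        · rw [hc, weightConst, hr']
          have hne : (1:ℝ)/2 - β ≠ 0 := by linarith
          have : Real.sqrt T * (9 * CI * δ * T ^ (β - 1) * (2:ℝ) ^ (1/2 + β) * (T ^ (1/2 - β) / (1/2 - β))) =
              9 * (2:ℝ) ^ (1/2 + β) * CI / (1/2 - β) * δ * (Real.sqrt T * (T ^ (β - 1) * T ^ (1/2 - β))) := by
            field_simp
          rw [this, ← hr', hpow, mul_one]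

/-- **Engine II, conclusion**, with `δ₀(β) = (1 - 1/√2)/(2 K_β)`. -/
theorem eq_zero_of_dev_weighted {C : ℝ} {u : ℝ → E3 → E3} (hu : IsTypeIAncientMild C u)
    {T₀ : ℝ} (hT₀ : T₀ ≤ 0) {β : ℝ} (hβ : β < 1/2)
    (hdev : ∀ τ < T₀, ∀ s : ℝ, 0 < s → s < -τ → ∀ y j k,
      |devStress u τ s j k y| ≤ (1 - 1 / Real.sqrt 2) / (2 * weightConst β) * (-τ) ^ (β - 1) * s ^ (-β)) :
    ∀ t < 0, ∀ x, u t x = 0 := by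
  have hK := weightConst_pos hβ
  set κ : ℝ := 1 - 1 / Real.sqrt 2 with hκ
  have hκ0 : 0 < κ := by rw [hκ]; linarith [one_div_sqrt_two_lt_one]
  have hδ0 : 0 ≤ κ / (2 * weightConst β) := by positivity
  set q : ℝ := 1 / Real.sqrt 2 with hq
  have hq0 : 0 ≤ q := by positivity
  have hq1 : q < 1 := one_div_sqrt_two_lt_one
  have hstep : ∀ M : ℝ, 0 ≤ M → (∀ τ < T₀, ∀ y, Real.sqrt (-τ) * ‖u τ y‖ ≤ M) →
      ∀ τ < T₀, ∀ y, Real.sqrt (-τ) * ‖u τ y‖ ≤ q * M + κ / 2 := by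
    intro M _ hM τ hτ y
    have h := step_weighted hu hT₀ hβ hδ0 hdev hM τ hτ y
    have e : weightConst β * (κ / (2 * weightConst β)) = κ / 2 := by field_simp
    rw [e] at h
    have e' : M / Real.sqrt 2 = 1 / Real.sqrt 2 * M := by ring
    rw [hq]
    linarith [e']
  have hlim := amplitude_le_of_affine_step hu hT₀ hq0 hq1 (by positivity) hstep
  have hm : κ / 2 / (1 - q) < 1 := by
    have h1q : 1 - q = κ := by rw [hκ, hq]
    rw [h1q, div_lt_one hκ0]
    linarith
  exact DiffusionMeter.eq_zero_of_small_backward_end hu hT₀ hm hlim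

end Summit.NavierStokesRegularity.NavierStokesRegularity.Theorems.ScenarioCensus.DeviatorMeter

end
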